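import Literature.Geometry.Symplectic.SteinLiouville
import HarnessLib

/-!
# The complex tangencies of a Stein domain satisfy the contact condition along the boundary

Topic `Literature/Geometry/Symplectic`; a proofs file below `SteinBoundaryContact.lean` /
`SteinLiouville.lean` (fact seat `provefact-Literature.Geometry.Symplectic.akbulut_matveyev`).
Akbulut–Matveyev (1998), §1 state: *"Boundary `∂X` of PC manifold `X` inherits a contact
structure `ξ`, which, in this case, is a distribution of maximal complex subspaces in `TX`
tangent to `∂X`"*; Gompf (1998), §1: *"Such a 2-plane field can be written as the kernel of a
nowhere zero 1-form `α` on `M` … We call `(M, ξ)` a contact manifold if `ξ` is completely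
nonintegrable in the sense that `α ∧ dα` is nowhere zero"*, and *"Consider a compact, complex
surface `X` with boundary `M`.  Each tangent space `T_xM` to `M` will contain a unique
1-dimensional complex subspace of `T_xX` (namely `T_xM ∩ iT_xM`).  If these complex lines
comprise a contact structure `ξ` on `M` …, then `X` has a strictly pseudoconvex boundary"*.

The tree has the 2-plane field `ξ = contactPlane S.J` (`SteinBoundaryContact.lean`; a `2`-plane
at every point, `SteinStructure.finrank_contactPlane`), the 1-form `α = -d^ℂφ`
(`SteinStructure.contactForm`; as a smooth form `-dComplex S.J S.φ`, `SteinLiouville.lean`) with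
`ξ_x = ker dφ_x ⊓ ker α_x` at boundary points (`SteinStructure.contactPlane_eq`), and
`dα = ω = -dd^ℂφ` (`SteinStructure.mextDeriv_liouvilleForm_apply`), but so far it did **not**
prove the contact condition (noted in the rendering notes of `LegendrianRealisation.lean`).
This file **proves** it, pointwise along `∂W` and in the preferred charts in which the whole
contact vocabulary of the tree is phrased:

* `SteinStructure.contactPlane_eq_boundaryTangentSpace_inf_ker` — at a boundary point,
  `ξ_x = T_x∂W ⊓ ker α_x`: **`ξ` is the kernel of the restriction of `α` to `T∂W`**;
* `SteinStructure.kahlerForm_contactPlane_nondegenerate` (and the same statement for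
  `d(-d^ℂφ)`, `mextDeriv_liouvilleForm_contactPlane_nondegenerate`) — **`dα|_ξ = ω|_ξ` is
  non-degenerate** at every point: `ξ_x` is `J`-invariant and `ω(v, Jv) > 0` for `v ≠ 0`
  (`J`-convexity of `φ`);
* `finrank_boundaryTangentSpace` (`dim T_x∂W = 3`), `SteinStructure.exists_contactForm_ne_zero`
  — **`α_x` does not vanish on `T_x∂W`** at a boundary point (otherwise `T_x∂W ≤ ξ_x`, of
  dimensions `3 ≤ 2`), so `ξ_x` is a hyperplane of `T_x∂W`
  (`SteinStructure.contactPlane_lt_boundaryTangentSpace`);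
* `SteinStructure.contactForm_wedge_kahlerForm_ne_zero` — **the contact condition
  `(α ∧ dα)_x ≠ 0` on `T_x∂W`** at every boundary point `x`: with
  `(α ∧ ω)(u, v, w) = α(u) ω(v, w) - α(v) ω(u, w) + α(w) ω(u, v)` (the alternating trilinear
  form `α ∧ dα` evaluated on three vectors, shuffle normalisation), the triple `u ∈ T_x∂W` with
  `α(u) ≠ 0`, `v ∈ ξ_x ∖ 0`, `w = Jv ∈ ξ_x` gives `(α ∧ ω)(u, v, Jv) = α(u) ω(v, Jv) ≠ 0`
  (`α(v) = α(Jv) = 0`).  A trilinear alternating form on the `3`-space `T_x∂W` that is non-zero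
  on one triple is non-zero on every basis, so this is Gompf's "`α ∧ dα` nowhere zero" for the
  restriction of `α` to `∂W` — pointwise; since `d` commutes with restriction to `∂W`
  (naturality of `mextDeriv` under pull-back, `ManifoldFormsPullback.lean`), the intrinsic
  3-form `α|_∂W ∧ d(α|_∂W)` of the closed 3-manifold `∂W`, once `∂W` is available as a manifold,
  is the restriction computed here.

Not addressed: the sign of `α ∧ dα` against the boundary orientation (positivity of the
contact structure, Gompf loc. cit.), and `∂W` as an abstract 3-manifold.

## References

* S. Akbulut, R. Matveyev, *A convex decomposition theorem for 4-manifolds*, IMRN 1998, no. 7,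
  371–381 (arXiv:math/0010166), §1. [AkbulutMatveyev1998]
* R. E. Gompf, *Handlebody construction of Stein surfaces*, Ann. of Math. 148 (1998), 619–693
  (arXiv:math/9803019), §1 (pp. 3–4 of the arXiv text). [Gompf1998]
* K. Cieliebak, Ya. Eliashberg, *From Stein to Weinstein and back*, AMS Coll. Publ. 59 (2012),
  Ch. 2 (J-convex hypersurfaces: the Levi form and the contact structure of a J-convex
  boundary). [CieliebakEliashberg2012]
-/

noncomputable section

open scoped Manifold ContDiff Topology
open Set Function Module

namespace Literature.Geometry.Symplectic

open Literature.Geometry.Kaehler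

/-- **`dim T_x∂W = 3`**: the boundary hyperplane `{v | v 0 = 0}` of the model half-space is the
kernel of the onto functional `v ↦ v 0` on `ℝ⁴`. [folklore] -/
theorem finrank_boundaryTangentSpace :
    finrank ℝ (boundaryTangentSpace : Submodule ℝ (EuclideanSpace ℝ (Fin 4))) = 3 := by
  have hsurj : Function.Surjective
      ((EuclideanSpace.proj (0 : Fin 4) : EuclideanSpace ℝ (Fin 4) →L[ℝ] ℝ).toLinearMap) := by
    intro r
    refine ⟨EuclideanSpace.single (0 : Fin 4) r, ?_⟩
    simp
  have h := ((EuclideanSpace.proj (0 : Fin 4) :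
    EuclideanSpace ℝ (Fin 4) →L[ℝ] ℝ).toLinearMap).finrank_range_add_finrank_ker
  rw [LinearMap.range_eq_top.2 hsurj, finrank_top, finrank_self, finrank_euclideanSpace_fin] at h
  unfold boundaryTangentSpace
  omega

variable {W : Type*} [TopologicalSpace W] [ChartedSpace (EuclideanHalfSpace 4) W]
  [IsManifold (𝓡∂ 4) ∞ W] [CompactSpace W]

namespace SteinStructure

/-! ### `ξ` is the kernel of `α` restricted to `T∂W` -/

/-- **`ξ_x = T_x∂W ⊓ ker α_x` at a boundary point `x`**: the complex tangencies are the kernel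
of the restriction of the contact form `α = -d^ℂφ` to the tangent space of the boundary
(`contactPlane_eq` with `ker dφ_x = T_x∂W`, `mfderiv_φ_apply_eq_zero_iff`).
[cite: Gompf1998, §1] -/
theorem contactPlane_eq_boundaryTangentSpace_inf_ker (S : SteinStructure W) {x : W}
    (hx : (𝓡∂ 4).IsBoundaryPoint x) :
    contactPlane S.J x =
      boundaryTangentSpace ⊓ LinearMap.ker (S.contactForm x).toLinearMap := by
  ext v
  rw [S.contactPlane_eq hx]
  simp only [Submodule.mem_inf, LinearMap.mem_ker, ContinuousLinearMap.coe_coe,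
    mem_boundaryTangentSpace_iff, S.mfderiv_φ_apply_eq_zero_iff hx]

/-! ### `dα = ω` is non-degenerate on `ξ` -/

/-- **`ω|_ξ` is non-degenerate** (at every point): a vector `v ∈ ξ_x` with `ω(v, w) = 0` for
all `w ∈ ξ_x` vanishes — test against `w = Jv ∈ ξ_x` (`ξ` is `J`-invariant) and use
`ω(v, Jv) > 0` for `v ≠ 0` (`J`-convexity).  With `dα = ω` this is the non-degeneracy half
of the contact condition for `ξ = ker(α|_{T∂W})`. [cite: AkbulutMatveyev1998, §1] -/
theorem kahlerForm_contactPlane_nondegenerate (S : SteinStructure W) (x : W)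
    {v : EuclideanSpace ℝ (Fin 4)}
    (hv : v ∈ contactPlane S.J x)
    (h : ∀ w ∈ contactPlane S.J x, S.kahlerForm x v w = 0) : v = 0 := by
  by_contra hv0
  have hJ : S.J x v ∈ contactPlane S.J x := (S.J_mem_contactPlane_iff x v).2 hv
  exact (S.kahlerForm_self_J_pos x hv0).ne' (h _ hJ)

/-- The same for the exterior derivative of the Liouville / contact form `-d^ℂφ`:
**`d(-d^ℂφ)` restricted to `ξ_x` is non-degenerate.** [cite: AkbulutMatveyev1998, §1] -/
theorem mextDeriv_liouvilleForm_contactPlane_nondegenerate (S : SteinStructure W) (x : W)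
    {v : EuclideanSpace ℝ (Fin 4)} (hv : v ∈ contactPlane S.J x)
    (h : ∀ w ∈ contactPlane S.J x, mextDeriv (-dComplex S.J S.φ) x ![v, w] = 0) : v = 0 :=
  S.kahlerForm_contactPlane_nondegenerate x hv fun w hw => by
    rw [← S.mextDeriv_liouvilleForm_apply]
    exact h w hw

/-- A non-zero vector of `ξ_x` pairs non-trivially under `ω` with some vector of `ξ_x`.
[folklore] -/
theorem exists_kahlerForm_ne_zero_of_mem_contactPlane (S : SteinStructure W) (x : W)
    {v : EuclideanSpace ℝ (Fin 4)}
    (hv : v ∈ contactPlane S.J x) (hv0 : v ≠ 0) :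
    ∃ w ∈ contactPlane S.J x, S.kahlerForm x v w ≠ 0 := by
  by_contra! h
  exact hv0 (S.kahlerForm_contactPlane_nondegenerate x hv h)

/-! ### `α` does not vanish on `T∂W`; the contact condition `α ∧ dα ≠ 0` -/

/-- **`α_x ≠ 0` on `T_x∂W` at a boundary point**: otherwise every vector tangent to the
boundary would lie in `ξ_x` (`mem_contactPlane_of_contactForm_eq_zero`), i.e. `T_x∂W ≤ ξ_x`,
contradicting `dim T_x∂W = 3 > 2 = dim ξ_x`. [cite: Gompf1998, §1] -/
theorem exists_contactForm_ne_zero (S : SteinStructure W) {x : W}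
    (hx : (𝓡∂ 4).IsBoundaryPoint x) :
    ∃ u ∈ (boundaryTangentSpace : Submodule ℝ (EuclideanSpace ℝ (Fin 4))),
      S.contactForm x u ≠ 0 := by
  by_contra! h
  have hle : (boundaryTangentSpace : Submodule ℝ (EuclideanSpace ℝ (Fin 4))) ≤ contactPlane S.J x :=
    fun u hu =>
    S.mem_contactPlane_of_contactForm_eq_zero hx ((mem_boundaryTangentSpace_iff u).1 hu) (h u hu)
  have h2 := S.finrank_contactPlane x
  have h3 := finrank_boundaryTangentSpace
  have hmono := Submodule.finrank_mono hle
  omega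

/-- **`ξ_x` is a proper subspace (a hyperplane) of `T_x∂W`** at a boundary point.
[cite: AkbulutMatveyev1998, §1] -/
theorem contactPlane_lt_boundaryTangentSpace (S : SteinStructure W) {x : W}
    (hx : (𝓡∂ 4).IsBoundaryPoint x) :
    contactPlane S.J x < (boundaryTangentSpace : Submodule ℝ (EuclideanSpace ℝ (Fin 4))) := by
  refine lt_of_le_of_ne (contactPlane_le_boundaryTangentSpace S.J x) fun heq => ?_
  obtain ⟨u, hu, hαu⟩ := S.exists_contactForm_ne_zero hx
  rw [← heq] at hu
  exact hαu (S.contactForm_apply_eq_zero hx hu)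

/-- A non-zero vector of the `2`-plane `ξ_x` exists. [folklore] -/
theorem exists_mem_contactPlane_ne_zero (S : SteinStructure W) (x : W) :
    ∃ v ∈ contactPlane S.J x, v ≠ 0 := by
  have h2 := S.finrank_contactPlane x
  have hnt : Nontrivial (contactPlane S.J x) :=
    Module.nontrivial_of_finrank_pos (R := ℝ) (by omega)
  obtain ⟨⟨v, hv⟩, hv0⟩ := exists_ne (0 : contactPlane S.J x)
  exact ⟨v, hv, fun h => hv0 (Subtype.ext h)⟩

/-- **The contact condition `(α ∧ dα)_x ≠ 0` on `T_x∂W`** at every boundary point `x` of a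
Stein domain, for `α = -d^ℂφ` (whose restriction to `T∂W` has kernel `ξ`) and `dα = ω`:
there are `u, v, w ∈ T_x∂W` with
`(α ∧ ω)(u, v, w) = α(u) ω(v, w) - α(v) ω(u, w) + α(w) ω(u, v) ≠ 0` — namely `u` with
`α(u) ≠ 0`, `v ∈ ξ_x ∖ 0` and `w = Jv`, for which the value is `α(u) ω(v, Jv) ≠ 0`.  As
`α ∧ ω` is trilinear and alternating and `dim T_x∂W = 3`, non-vanishing on one triple is
non-vanishing of the 3-form `(α ∧ dα)|_{T_x∂W}`: *"`∂X` of PC manifold `X` inherits a contact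
structure `ξ` … a distribution of maximal complex subspaces in `TX` tangent to `∂X`"* (AM §1),
*"completely nonintegrable in the sense that `α ∧ dα` is nowhere zero"* (Gompf §1).
[cite: AkbulutMatveyev1998, §1] -/
theorem contactForm_wedge_kahlerForm_ne_zero (S : SteinStructure W) {x : W}
    (hx : (𝓡∂ 4).IsBoundaryPoint x) :
    ∃ u ∈ (boundaryTangentSpace : Submodule ℝ (EuclideanSpace ℝ (Fin 4))),
      ∃ v ∈ (boundaryTangentSpace : Submodule ℝ (EuclideanSpace ℝ (Fin 4))),
      ∃ w ∈ (boundaryTangentSpace : Submodule ℝ (EuclideanSpace ℝ (Fin 4))),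
        S.contactForm x u * S.kahlerForm x v w - S.contactForm x v * S.kahlerForm x u w
          + S.contactForm x w * S.kahlerForm x u v ≠ 0 := by
  obtain ⟨u, hu, hαu⟩ := S.exists_contactForm_ne_zero hx
  obtain ⟨v, hv, hv0⟩ := S.exists_mem_contactPlane_ne_zero x
  have hJv : S.J x v ∈ contactPlane S.J x := (S.J_mem_contactPlane_iff x v).2 hv
  refine ⟨u, hu, v, contactPlane_le_boundaryTangentSpace S.J x hv, S.J x v,
    contactPlane_le_boundaryTangentSpace S.J x hJv, ?_⟩
  rw [S.contactForm_apply_eq_zero hx hv, S.contactForm_apply_eq_zero hx hJv, zero_mul, zero_mul,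
    sub_zero, add_zero]
  exact mul_ne_zero hαu (S.kahlerForm_self_J_pos x hv0).ne'

/-- The value of `α ∧ ω` on the adapted triple `(u, v, Jv)`, `v ∈ ξ_x`:
`(α ∧ ω)(u, v, Jv) = α(u) ω(v, Jv)`. [folklore] -/
theorem contactForm_wedge_kahlerForm_apply_J (S : SteinStructure W) {x : W}
    (hx : (𝓡∂ 4).IsBoundaryPoint x) (u : EuclideanSpace ℝ (Fin 4)) {v : EuclideanSpace ℝ (Fin 4)}
    (hv : v ∈ contactPlane S.J x) :
    S.contactForm x u * S.kahlerForm x v (S.J x v) - S.contactForm x v * S.kahlerForm x u (S.J x v)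
        + S.contactForm x (S.J x v) * S.kahlerForm x u v
      = S.contactForm x u * S.kahlerForm x v (S.J x v) := by
  have hJv : S.J x v ∈ contactPlane S.J x := (S.J_mem_contactPlane_iff x v).2 hv
  rw [S.contactForm_apply_eq_zero hx hv, S.contactForm_apply_eq_zero hx hJv, zero_mul, zero_mul,
    sub_zero, add_zero]

end SteinStructure

end Literature.Geometry.Symplectic

end
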